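import Mathlib.Analysis.Calculus.DifferentialForm.Basic
import Mathlib.Analysis.Calculus.ContDiff.Operations
import Mathlib.Analysis.Calculus.Deriv.Comp
import Mathlib.Analysis.Calculus.Deriv.Add
import Mathlib.Analysis.Calculus.Deriv.Mul
import Mathlib.Analysis.Convex.Basic
import Mathlib.MeasureTheory.Integral.Bochner.Basic
import Mathlib.MeasureTheory.Measure.Lebesgue.Basic
import HarnessLib

/-!
# Cone-cubes: straight simplices in a real vector space parametrised by the unit cube, and the
# periods of differential forms over them

For points `x₀, …, x_q` of a real vector space `W` the **cone-cube** (iterated join)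

  `κ(x₀, …, x_q)(t₀, …, t_{q-1}) = (1 - t₀) x₀ + t₀ κ(x₁, …, x_q)(t₁, …, t_{q-1})`,  `κ(x₀)() = x₀`,

is a polynomial map `ℝ^q → W` sending the unit cube `[0,1]^q` onto the straight simplex `[x₀, …, x_q]`
(so into any convex set containing the points).  It is the device of Eilenberg / Dupont (simplicial de
Rham theory) and of the Eisenstein-cocycle literature (Sczech) for turning differential forms into
cochains by integration: the **cone period** of a `q`-form `ω` on `W` over `[x₀, …, x_q]` is
`∫_{[0,1]^q} κ*ω`.  Linear (indeed affine) maps commute with cone-cubes ON THE NOSE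
(`coneCube_comp_linear`, `coneCube_add_const`), which is what makes cone periods of forms on a convex
cone with a linear group action equivariant for free.

This file contains the definitions and the (elementary) algebra and calculus of cone-cubes needed for
the cocycle identity of cone periods of closed forms (`ConePeriodCocycle.lean`):

* `coneCube`, `coneCube_zero`, `coneCube_succ`, `coneCube_comp_linear`, `coneCube_add_const`,
  `coneCube_mem_of_convex`;
* the faces of the cube: `coneCube_insertNth_one` (the face `tᵢ = 1` is the cone-cube of the points
  with `xᵢ` deleted), `coneCube_snoc_zero` (the face `t_{q-1} = 0` deletes the last point),
  `coneCube_congr_of_apply_eq_zero` (on the face `tᵢ = 0` the cone-cube does not depend on the later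
  parameters — the degenerate faces);
* calculus: `contDiff_coneCube`, the directional derivatives on the faces
  (`fderiv_coneCube_insertNth_one`, `fderiv_coneCube_snoc_zero`) and their vanishing on the
  degenerate faces (`fderiv_coneCube_eq_zero_of_apply_eq_zero`);
* `conePeriod q ω x = ∫_{t ∈ [0,1]^q} ω(κ x t)(∂₀κ, …, ∂_{q-1}κ)`.

## References

* J. L. Dupont, *Simplicial de Rham cohomology and characteristic classes of flat bundles*,
  Topology 15 (1976), 233–245, §1–2. [Dupont1976]
* R. Sczech, *Eisenstein cocycles for GL₂ℚ and values of L-functions in real quadratic fields*,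
  Comment. Math. Helv. 67 (1992), 363–382, §1 (cones and their parametrisation). [Sczech1992]
* M. Spivak, *Calculus on Manifolds*, Benjamin 1965, Ch. 4 (singular cubes, chains). [Spivak1965]
-/

noncomputable section

open Set MeasureTheory

namespace Literature.Analysis.Calculus

/-! ### Cone-cubes: definition and algebra -/

section Algebra

variable {W : Type*} [AddCommGroup W] [Module ℝ W]

/-- The **cone-cube** `κ(x₀,…,x_q)(t₀,…,t_{q-1}) = (1 - t₀) x₀ + t₀ κ(x₁,…,x_q)(t₁,…,t_{q-1})`: the
straight `q`-simplex `[x₀,…,x_q]` of a real vector space parametrised by the cube `ℝ^q` (iterated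
join; Eilenberg, Dupont, Sczech). [cite: Dupont1976, §1] -/
def coneCube : (q : ℕ) → (Fin (q + 1) → W) → (Fin q → ℝ) → W
  | 0, x, _ => x 0
  | q + 1, x, t => (1 - t 0) • x 0 + t 0 • coneCube q (fun i => x i.succ) (fun j => t j.succ)

/-- `κ(x₀)() = x₀`. [folklore] -/
@[simp]
theorem coneCube_zero (x : Fin 1 → W) (t : Fin 0 → ℝ) : coneCube 0 x t = x 0 :=
  rfl

/-- The defining recursion of the cone-cube. [folklore] -/
theorem coneCube_succ (q : ℕ) (x : Fin (q + 2) → W) (t : Fin (q + 1) → ℝ) :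
    coneCube (q + 1) x t =
      (1 - t 0) • x 0 + t 0 • coneCube q (fun i => x i.succ) (fun j => t j.succ) :=
  rfl

/-- The recursion read with `Fin.cons`: `κ(x)(s, t) = (1 - s) x₀ + s κ(x ∘ succ)(t)`. [folklore] -/
theorem coneCube_cons (q : ℕ) (x : Fin (q + 2) → W) (s : ℝ) (t : Fin q → ℝ) :
    coneCube (q + 1) x (Fin.cons s t) =
      (1 - s) • x 0 + s • coneCube q (fun i => x i.succ) t := by
  simp only [coneCube_succ, Fin.cons_zero, Fin.cons_succ]

/-- **Equivariance is free**: for a LINEAR map `A`, `κ(A x₀, …, A x_q) = A ∘ κ(x₀, …, x_q)`.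
[cite: Dupont1976, §1] -/
theorem coneCube_comp_linear {W' : Type*} [AddCommGroup W'] [Module ℝ W'] (A : W →ₗ[ℝ] W') :
    ∀ (q : ℕ) (x : Fin (q + 1) → W) (t : Fin q → ℝ), coneCube q (⇑A ∘ x) t = A (coneCube q x t)
  | 0, x, t => rfl
  | q + 1, x, t => by
      simp only [coneCube_succ, Function.comp_apply, map_add, map_smul]
      congr 1
      rw [← coneCube_comp_linear A q (fun i => x i.succ) (fun j => t j.succ)]
      rfl

/-- Cone-cubes commute with translations: `κ(x₀ + c, …, x_q + c) = κ(x₀, …, x_q) + c` (the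
cone-cube is an affine combination of the points). [folklore] -/
theorem coneCube_add_const (c : W) :
    ∀ (q : ℕ) (x : Fin (q + 1) → W) (t : Fin q → ℝ),
      coneCube q (fun i => x i + c) t = coneCube q x t + c
  | 0, x, t => rfl
  | q + 1, x, t => by
      simp only [coneCube_succ]
      rw [coneCube_add_const c q (fun i => x i.succ) (fun j => t j.succ), smul_add, smul_add,
        add_add_add_comm, ← add_smul, sub_add_cancel, one_smul]

/-- Cone-cubes of points of a CONVEX set, at parameters in `[0,1]`, stay in the set. [folklore] -/
theorem coneCube_mem_of_convex {X : Set W} (hX : Convex ℝ X) :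
    ∀ (q : ℕ) {x : Fin (q + 1) → W} (_ : ∀ i, x i ∈ X) {t : Fin q → ℝ}
      (_ : ∀ j, t j ∈ Icc (0 : ℝ) 1), coneCube q x t ∈ X
  | 0, x, hx, t, _ => hx 0
  | q + 1, x, hx, t, ht => by
      simp only [coneCube_succ]
      have h0 := ht 0
      exact hX (hx 0) (coneCube_mem_of_convex hX q (fun i => hx i.succ) (fun j => ht j.succ))
        (by linarith [h0.2]) h0.1 (by ring)

/-- **The front faces**: on the face `tᵢ = 1` of the cube the cone-cube of `x₀, …, x_{q+1}` is the
cone-cube of the points with `xᵢ` deleted (`i ≤ q`), in the remaining parameters. [cite: Dupont1976, §1] -/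
theorem coneCube_insertNth_one :
    ∀ (q : ℕ) (x : Fin (q + 2) → W) (i : Fin (q + 1)) (y : Fin q → ℝ),
      coneCube (q + 1) x (i.insertNth 1 y) =
        coneCube q (fun j => x ((Fin.castSucc i).succAbove j)) y
  | 0, x, i, y => by
      obtain rfl : i = 0 := Fin.eq_zero i
      simp [coneCube_succ, Fin.insertNth_zero']
  | q + 1, x, i, y => by
      induction i using Fin.cases with
      | zero =>
          rw [Fin.insertNth_zero', coneCube_cons]
          simp only [sub_self, zero_smul, one_smul, zero_add, Fin.castSucc_zero, Fin.succAbove_zero]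
      | succ i =>
          rw [← Fin.cons_self_tail y, Fin.insertNth_succ_cons, coneCube_cons, coneCube_cons,
            coneCube_insertNth_one q (fun k => x k.succ) i (Fin.tail y)]
          have h0 : (Fin.castSucc i.succ).succAbove 0 = 0 := by
            rw [Fin.castSucc_succ]; exact Fin.succ_succAbove_zero _
          have hs : ∀ j : Fin (q + 1), (Fin.castSucc i.succ).succAbove j.succ =
              ((Fin.castSucc i).succAbove j).succ := fun j => by
            rw [Fin.castSucc_succ]; exact Fin.succ_succAbove_succ _ _
          simp only [h0, hs]

/-- **The last back face**: on the face `t_q = 0` the cone-cube of `x₀, …, x_{q+1}` is the cone-cube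
of `x₀, …, x_q` (the last point deleted). [cite: Dupont1976, §1] -/
theorem coneCube_snoc_zero :
    ∀ (q : ℕ) (x : Fin (q + 2) → W) (y : Fin q → ℝ),
      coneCube (q + 1) x (Fin.snoc y 0) = coneCube q (fun j => x (Fin.castSucc j)) y
  | 0, x, y => by
      have : (Fin.snoc y (0 : ℝ) : Fin 1 → ℝ) = Fin.cons 0 y := by
        funext j; obtain rfl : j = 0 := Fin.eq_zero j; rfl
      rw [this, coneCube_cons]
      simp
  | q + 1, x, y => by
      rw [← Fin.cons_self_tail y, ← Fin.cons_snoc_eq_snoc_cons, coneCube_cons, coneCube_cons,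
        coneCube_snoc_zero q (fun k => x k.succ) (Fin.tail y)]
      rfl

/-- **The degenerate faces**: if `tᵢ = 0`, the cone-cube does not depend on the parameters after
`i`: two parameter vectors with `tᵢ = 0` agreeing up to `i` give the same point. [folklore] -/
theorem coneCube_congr_of_apply_eq_zero :
    ∀ (q : ℕ) (x : Fin (q + 1) → W) (i : Fin q) (t t' : Fin q → ℝ), t i = 0 →
      (∀ l : Fin q, (l : ℕ) ≤ i → t l = t' l) → coneCube q x t = coneCube q x t'
  | 0, x, i, t, t', _, _ => rfl
  | q + 1, x, i, t, t', hi, h => by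
      have h0 : t 0 = t' 0 := h 0 (Nat.zero_le _)
      induction i using Fin.cases with
      | zero =>
          simp only [coneCube_succ, ← h0, hi, sub_zero, one_smul, zero_smul, add_zero]
      | succ i =>
          simp only [coneCube_succ, ← h0]
          rw [coneCube_congr_of_apply_eq_zero q (fun k => x k.succ) i (fun j => t j.succ)
            (fun j => t' j.succ) hi fun l hl => h l.succ (by simpa using hl)]

end Algebra

/-! ### Calculus of cone-cubes -/

section Calculus

variable {W : Type*} [NormedAddCommGroup W] [NormedSpace ℝ W]

/-- Cone-cubes are smooth in the parameters (they are polynomial). [folklore] -/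
theorem contDiff_coneCube {n : WithTop ℕ∞} :
    ∀ (q : ℕ) (x : Fin (q + 1) → W), ContDiff ℝ n (coneCube q x)
  | 0, x => contDiff_const
  | q + 1, x => by
      have h0 : ContDiff ℝ n fun t : Fin (q + 1) → ℝ => t 0 := contDiff_apply ℝ ℝ 0
      have htail : ContDiff ℝ n fun t : Fin (q + 1) → ℝ => fun j : Fin q => t j.succ :=
        contDiff_pi.mpr fun j => contDiff_apply ℝ ℝ j.succ
      exact ((contDiff_const.sub h0).smul contDiff_const).add
        (h0.smul ((contDiff_coneCube q _).comp htail))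

/-- Cone-cubes are differentiable in the parameters. [folklore] -/
theorem differentiable_coneCube (q : ℕ) (x : Fin (q + 1) → W) :
    Differentiable ℝ (coneCube q x) :=
  (contDiff_coneCube (n := 1) q x).differentiable one_ne_zero

/-- Cone-cubes are continuous in the parameters. [folklore] -/
theorem continuous_coneCube (q : ℕ) (x : Fin (q + 1) → W) : Continuous (coneCube q x) :=
  (differentiable_coneCube q x).continuous

/-- A directional derivative of a differentiable map is the derivative along the line:
`Df(t) v = (d/ds) f(t + s v) |_{s=0}`. [folklore] -/
theorem fderiv_apply_eq_deriv_line {q : ℕ} {f : (Fin q → ℝ) → W} (hf : Differentiable ℝ f)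
    (t v : Fin q → ℝ) : fderiv ℝ f t v = deriv (fun s : ℝ => f (t + s • v)) 0 := by
  have hγ : HasDerivAt (fun s : ℝ => t + s • v) v 0 := by
    simpa using ((hasDerivAt_id (0 : ℝ)).smul_const v).const_add t
  have h : HasDerivAt (fun s : ℝ => f (t + s • v)) (fderiv ℝ f t v) 0 := by
    have hft : HasFDerivAt f (fderiv ℝ f (t + (0 : ℝ) • v)) (t + (0 : ℝ) • v) :=
      (hf _).hasFDerivAt
    have h' := hft.comp_hasDerivAt (0 : ℝ) hγ
    simpa [Function.comp_def] using h'
  exact h.deriv.symm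

/-- The basis vector `e_{succAbove i j}` of `ℝ^{q+1}` is `e_j ∈ ℝ^q` inserted with a `0` at `i`.
[folklore] -/
theorem insertNth_zero_single (q : ℕ) (i : Fin (q + 1)) (j : Fin q) (c : ℝ) :
    (i.insertNth (α := fun _ => ℝ) 0 (Pi.single j c) : Fin (q + 1) → ℝ) =
      Pi.single (i.succAbove j) c := by
  funext l
  cases l using Fin.succAboveCases i with
  | x => simp
  | p l =>
      rw [Fin.insertNth_apply_succAbove]
      by_cases h : l = j
      · subst h; simp
      · rw [Pi.single_eq_of_ne h, Pi.single_eq_of_ne]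
        exact fun h' => h (Fin.succAbove_right_injective h')

/-- Moving along `e_{succAbove i j}` from a point of the face `tᵢ = a` stays in the face:
`insertNth i a y + s e_{succAbove i j} = insertNth i a (y + s e_j)`. [folklore] -/
theorem insertNth_add_smul_single (q : ℕ) (i : Fin (q + 1)) (a : ℝ) (y : Fin q → ℝ) (j : Fin q)
    (s : ℝ) :
    (i.insertNth (α := fun _ => ℝ) a y : Fin (q + 1) → ℝ) + s • Pi.single (i.succAbove j) 1 =
      i.insertNth (α := fun _ => ℝ) a (y + s • Pi.single j 1) := by
  funext l
  cases l using Fin.succAboveCases i with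
  | x => simp
  | p l =>
      simp only [Pi.add_apply, Pi.smul_apply, Fin.insertNth_apply_succAbove]
      by_cases h : l = j
      · subst h; simp
      · rw [Pi.single_eq_of_ne h, Pi.single_eq_of_ne]
        exact fun h' => h (Fin.succAbove_right_injective h')

/-- **Derivatives on the front faces**: the directional derivative of `κ(x₀,…,x_{q+1})` at a point
of the face `tᵢ = 1` along a direction `e_{succAbove i j}` of the face is the corresponding
derivative of the cone-cube of the face. [folklore] -/
theorem fderiv_coneCube_insertNth_one (q : ℕ) (x : Fin (q + 2) → W) (i : Fin (q + 1))
    (y : Fin q → ℝ) (j : Fin q) :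
    fderiv ℝ (coneCube (q + 1) x) (i.insertNth 1 y) (Pi.single (i.succAbove j) 1) =
      fderiv ℝ (coneCube q fun k => x ((Fin.castSucc i).succAbove k)) y (Pi.single j 1) := by
  rw [fderiv_apply_eq_deriv_line (differentiable_coneCube _ _),
    fderiv_apply_eq_deriv_line (differentiable_coneCube _ _)]
  congr 1
  ext s
  rw [insertNth_add_smul_single, coneCube_insertNth_one]

/-- **Derivatives on the last back face**: the directional derivative of `κ(x₀,…,x_{q+1})` at a
point of the face `t_q = 0` along `e_{castSucc j}` is the corresponding derivative of
`κ(x₀,…,x_q)`. [folklore] -/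
theorem fderiv_coneCube_snoc_zero (q : ℕ) (x : Fin (q + 2) → W) (y : Fin q → ℝ) (j : Fin q) :
    fderiv ℝ (coneCube (q + 1) x) (Fin.snoc y 0) (Pi.single (Fin.castSucc j) 1) =
      fderiv ℝ (coneCube q fun k => x (Fin.castSucc k)) y (Pi.single j 1) := by
  rw [fderiv_apply_eq_deriv_line (differentiable_coneCube _ _),
    fderiv_apply_eq_deriv_line (differentiable_coneCube _ _)]
  congr 1
  ext s
  have h := insertNth_add_smul_single q (Fin.last q) 0 y j s
  rw [Fin.succAbove_last, Fin.insertNth_last', Fin.insertNth_last'] at h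
  rw [h, coneCube_snoc_zero]

/-- **The degenerate back faces carry no volume**: at a point with `tᵢ = 0` the derivative of the
cone-cube along any later coordinate direction `e_l`, `i < l`, vanishes. [folklore] -/
theorem fderiv_coneCube_eq_zero_of_apply_eq_zero (q : ℕ) (x : Fin (q + 1) → W) (t : Fin q → ℝ)
    (i l : Fin q) (hi : t i = 0) (hil : (i : ℕ) < l) :
    fderiv ℝ (coneCube q x) t (Pi.single l 1) = 0 := by
  rw [fderiv_apply_eq_deriv_line (differentiable_coneCube _ _)]
  have : (fun s : ℝ => coneCube q x (t + s • Pi.single l 1)) = fun _ => coneCube q x t := by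
    ext s
    refine (coneCube_congr_of_apply_eq_zero q x i t _ hi fun m hm => ?_).symm
    have hml : m ≠ l := fun h => by subst h; exact absurd hm (not_le.mpr hil)
    simp [Pi.single_eq_of_ne hml]
  rw [this, deriv_const]

end Calculus

/-! ### Cone periods -/

section Period

variable {W : Type*} [NormedAddCommGroup W] [NormedSpace ℝ W]
  {F : Type*} [NormedAddCommGroup F] [NormedSpace ℝ F]

/-- The **cone period** of an `F`-valued `q`-form `ω` on `W` over the straight simplex `[x₀,…,x_q]`:
`∫_{[0,1]^q} κ*ω = ∫_{t ∈ [0,1]^q} ω(κ(x)(t))(∂₀κ(x)(t), …, ∂_{q-1}κ(x)(t)) dt`.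
[cite: Dupont1976, §1–2] [cite: Sczech1992, §1] -/
def conePeriod (q : ℕ) (ω : W → W [⋀^Fin q]→L[ℝ] F) (x : Fin (q + 1) → W) : F :=
  ∫ t in Icc (0 : Fin q → ℝ) 1,
    ω (coneCube q x t) (fun j => fderiv ℝ (coneCube q x) t (Pi.single j 1))

/-- Unfolding lemma for `conePeriod`. [folklore] -/
theorem conePeriod_def (q : ℕ) (ω : W → W [⋀^Fin q]→L[ℝ] F) (x : Fin (q + 1) → W) :
    conePeriod q ω x = ∫ t in Icc (0 : Fin q → ℝ) 1,
      ω (coneCube q x t) (fun j => fderiv ℝ (coneCube q x) t (Pi.single j 1)) :=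
  rfl

end Period

end Literature.Analysis.Calculus

end
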